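import Summits.AnomalousDissipation.AnomalousDissipation.Theorems.SolenoidalFractalHomogenisationLagrangianStepFrameToEulerianKinematics
import Summits.AnomalousDissipation.AnomalousDissipation.Theorems.SolenoidalFractalHomogenisationLagrangianStepFrameSmoothAllTimes
import Literature.Analysis.FunctionSpaces.TorusDerivBounds
import HarnessLib

/-!
# K1L_D (stmt-AnomalousDissipation-27980), v2 road (memo L22 §4/§6, tenure RULING D28-10 (c)) step (K1): the BACKWARD frame reading
# `x ↦ Ψ τ (X m r₀ (t′ τ) x)` — chain rule with the CLOSED-FORM backward derivative and all-orders joint continuity by closure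
(helper, `--supports 27980 --as helper`; prover lead-k1l-onelevel-p1 g7.)

The converse of (C6) `FrameConj.isWeakTensorPassiveVectorOn_read` (Eulerian weak solution ⇒ its frame reading is a DISTORTED weak solution, the
`exists_sol` of the v2 propagator spec) needs the Eulerian test `Φ τ x := Ψ τ (X m r₀ (t′ τ) x)` of an admissible distorted test `Ψ` to be an
`IsLipschitzSpaceTimeTest`, in particular ALL iterated `x`-derivatives of `Φ` jointly continuous in `(τ, x)`.  No inverse-function induction is needed:
the backward derivative is KNOWN in closed form, `D(X m r₀ t′)(x) = frameG E m t′ r₀ (X m r₀ t′ x)` (derivative group law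
`FrameConj.flowDeriv_comp_inverse_apply` + `frameG_comp_inv_eq`, all times), hence
* `partialDeriv_comp_backward` — `∂_i (θ ∘ X m r₀ t′)(x) = Σ_c G_{c i}(y)·(∂_c θ)(y)`, `y = X m r₀ t′ x`, `G = frameG E m t′ r₀`;
* the CLOSURE CLASS `SmoothFamily f` («smooth slices, every iterated space derivative jointly continuous in `(τ, y)`») is closed under `∂_c`, sums and
  products by scalar families (`SmoothFamily.partialDeriv/add/smul/sum`, Leibniz by induction on the derivative word read from the right);
* **`continuous_uncurry_iterPartialDeriv_comp_backward`** — if `Ψ ∈ SmoothFamily` and the frame entries `(τ, y) ↦ frameG E m (t′ τ) r₀ y c i` are in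
  `SmoothFamily` (for the clamped exact-flow clock this is FR2 + adjugate; taken here as the hypothesis `hG`), then every
  `iterPartialDeriv l (fun x => Ψ τ (X m r₀ (t′ τ) x))` is jointly continuous in `(τ, x)` — by induction on the word: `∂^{l++[c]}(Ψ τ ∘ Xb τ) =
  ∂^l((T_c Ψ) τ ∘ Xb τ)` with `T_c Ψ := Σ_i Gt_{i c}·∂_i Ψ ∈ SmoothFamily`, and at the bottom the composite of a jointly continuous family with the
  jointly continuous backward maps (`FrameConj.continuous_X_uncurry_snd`).
No sorry, no definition of route objects (the closure class is a local `def … : Prop` device), no named fact.  NOT a proof of the converse reading lemma,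
of `stub_Vmod_EHTthg`, of K1L_D or AD; rung F-D1.A0.
-/

set_option linter.dupNamespace false

noncomputable section

namespace Summit.AnomalousDissipation.AnomalousDissipation.Theorems.SolenoidalFractalHomogenisation.LagrangianStep.FrameConj

open Set Function Filter MeasureTheory Topology
open scoped NNReal ENNReal InnerProductSpace ContDiff
open Literature.Analysis Literature.Analysis.FunctionSpaces Literature.Analysis.FunctionSpaces.Torus
open Literature.Analysis.FluidPDE Literature.Analysis.FluidPDE.LatticeShear
open Literature.Analysis.FluidPDE.LatticeShear (LagrangianLatticeCarrier)
open Summit.AnomalousDissipation.AnomalousDissipation.Theorems.SolenoidalFractalHomogenisation.LagrangianCarrier (fderiv_comp_displacement)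

variable {k : ℕ}
variable {F : Type*} [NormedAddCommGroup F] [NormedSpace ℝ F]

/-! ## §1 The backward chain rule with the closed-form backward derivative -/

/-- **The derivative of the backward map is the forward frame at the image point**: `flowDeriv m r₀ t′ x w = frameG E m t′ r₀ (X m r₀ t′ x) · w`. -/
theorem flowDeriv_backward_apply (E : LagrangianLatticeCarrier k) (hR : E.LevelRegular) (m : ℕ) (r₀ t' : ℝ) (x : UnitAddTorus (Fin 3))
    (w : EuclideanSpace ℝ (Fin 3)) :
    E.flowDeriv m r₀ t' x w = WithLp.toLp 2 ((frameG E m t' r₀ (E.X m r₀ t' x)).mulVec (WithLp.ofLp w)) :=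
  (frameG_comp_inv_eq E m t' r₀ x (isUnit_frameJac E hR m t' r₀ _) (flowDeriv_comp_inverse_apply E hR m r₀ t' x) w).symm

/-- **Backward chain rule for the torus derivative**: `D(θ ∘ X m r₀ t′)(x) = Dθ(y) ∘ D(X m r₀ t′)(x)`, `y = X m r₀ t′ x`. -/
theorem fderiv_comp_backward (E : LagrangianLatticeCarrier k) (hR : E.LevelRegular) (m : ℕ) (r₀ t' : ℝ) {θ : UnitAddTorus (Fin 3) → F}
    (hθ : IsSmooth θ) (x : UnitAddTorus (Fin 3)) :
    Torus.fderiv (fun x => θ (E.X m r₀ t' x)) x = (Torus.fderiv θ (E.X m r₀ t' x)).comp (E.flowDeriv m r₀ t' x) := by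
  have h := fderiv_comp_displacement hθ (hR.isSmooth_disp m r₀ t') x
  rw [flowDeriv_eq_id_add_fderiv]
  have e : (fun x => θ (E.X m r₀ t' x)) = fun x => θ (x + proj (E.disp m r₀ t' x)) := by
    funext x; rw [LagrangianLatticeCarrier.X_apply]
  rw [e, h, LagrangianLatticeCarrier.X_apply]

/-- **Backward chain rule, coordinates**: `∂_i (θ ∘ X m r₀ t′)(x) = Σ_c G_{c i}(y) • (∂_c θ)(y)`, `y = X m r₀ t′ x`, `G = frameG E m t′ r₀`. -/
theorem partialDeriv_comp_backward (E : LagrangianLatticeCarrier k) (hR : E.LevelRegular) (m : ℕ) (r₀ t' : ℝ) {θ : UnitAddTorus (Fin 3) → F}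
    (hθ : IsSmooth θ) (i : Fin 3) (x : UnitAddTorus (Fin 3)) :
    Torus.partialDeriv i (fun x => θ (E.X m r₀ t' x)) x
      = ∑ c, frameG E m t' r₀ (E.X m r₀ t' x) c i • Torus.partialDeriv c θ (E.X m r₀ t' x) := by
  have hcomp : IsSmooth (fun x => θ (E.X m r₀ t' x)) := by
    have h := Literature.Analysis.ODE.TorusFlow.isSmooth_comp_add_proj hθ (hR.isSmooth_disp m r₀ t')
    have e : (fun x => θ (E.X m r₀ t' x)) = fun x => θ (x + proj (E.disp m r₀ t' x)) := by
      funext x; rw [LagrangianLatticeCarrier.X_apply]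
    rw [e]; exact h
  rw [partialDeriv_eq_fderiv_apply (hcomp.isContDiff (by simp)), fderiv_comp_backward E hR m r₀ t' hθ x,
    ContinuousLinearMap.comp_apply, flowDeriv_backward_apply E hR m r₀ t' x]
  set y := E.X m r₀ t' x with hy
  have hv : (WithLp.toLp 2 ((frameG E m t' r₀ y).mulVec (WithLp.ofLp (EuclideanSpace.single i (1:ℝ)))) : EuclideanSpace ℝ (Fin 3))
      = ∑ c, frameG E m t' r₀ y c i • EuclideanSpace.single c (1:ℝ) := by
    ext c
    simp [Matrix.mulVec, dotProduct, Pi.single_apply, Finset.sum_apply]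
  rw [hv, map_sum]
  refine Finset.sum_congr rfl fun c _ => ?_
  rw [map_smul, partialDeriv_eq_fderiv_apply (hθ.isContDiff (by simp))]

/-! ## §2 The closure class: smooth slices, every iterated space derivative jointly continuous -/

/-- (device) A time-dependent field has smooth slices and all its iterated space derivatives are jointly continuous in `(τ, y)`. -/
def SmoothFamily {F : Type*} [NormedAddCommGroup F] [NormedSpace ℝ F] (f : ℝ → UnitAddTorus (Fin 3) → F) : Prop :=
  (∀ τ, IsSmooth (f τ)) ∧ ∀ l : List (Fin 3), Continuous (uncurry fun τ y => iterPartialDeriv l (f τ) y)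

omit [NormedSpace ℝ F] in
/-- Joint continuity transfers along a pointwise identity of families. -/
private theorem continuous_uncurry_congr {f g : ℝ → UnitAddTorus (Fin 3) → F} (h : ∀ τ y, f τ y = g τ y) (hg : Continuous (uncurry g)) :
    Continuous (uncurry f) := by
  have : uncurry f = uncurry g := funext fun p => h p.1 p.2
  rw [this]; exact hg

/-- The class contains its space derivatives. -/
theorem SmoothFamily.partialDeriv {f : ℝ → UnitAddTorus (Fin 3) → F} (hf : SmoothFamily f) (c : Fin 3) :
    SmoothFamily (fun τ => Torus.partialDeriv c (f τ)) :=
  ⟨fun τ => (hf.1 τ).partialDeriv c, fun l => by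
    refine continuous_uncurry_congr (g := fun τ y => iterPartialDeriv (l ++ [c]) (f τ) y) (fun τ y => ?_) (hf.2 (l ++ [c]))
    rw [iterPartialDeriv_concat]⟩

/-- The class is closed under addition. -/
theorem SmoothFamily.add {f g : ℝ → UnitAddTorus (Fin 3) → F} (hf : SmoothFamily f) (hg : SmoothFamily g) :
    SmoothFamily (fun τ y => f τ y + g τ y) :=
  ⟨fun τ => (hf.1 τ).add (hg.1 τ), fun l => by
    refine continuous_uncurry_congr (g := fun τ y => iterPartialDeriv l (f τ) y + iterPartialDeriv l (g τ) y) (fun τ y => ?_)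
      ((hf.2 l).add (hg.2 l))
    rw [iterPartialDeriv_add (hf.1 τ) (hg.1 τ) l]⟩

/-- The zero family is in the class. -/
theorem SmoothFamily.zero : SmoothFamily (fun (_ : ℝ) (_ : UnitAddTorus (Fin 3)) => (0 : F)) :=
  ⟨fun _ => isSmooth_const _, fun l => by
    cases l with
    | nil => exact continuous_const
    | cons i l =>
      refine continuous_uncurry_congr (g := fun _ _ => (0 : F)) (fun τ y => ?_) continuous_const
      rw [iterPartialDeriv_const (0 : F) (i :: l) (List.cons_ne_nil i l)]; rfl⟩

/-- The class is closed under finite sums. -/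
theorem SmoothFamily.sum {ι : Type*} (s : Finset ι) {f : ι → ℝ → UnitAddTorus (Fin 3) → F} (hf : ∀ i ∈ s, SmoothFamily (f i)) :
    SmoothFamily (fun τ y => ∑ i ∈ s, f i τ y) := by
  classical
  induction s using Finset.induction_on with
  | empty => simpa using (SmoothFamily.zero (F := F))
  | insert a s ha ih =>
    have h := (hf a (Finset.mem_insert_self a s)).add (ih fun i hi => hf i (Finset.mem_insert_of_mem hi))
    refine ⟨fun τ => ?_, fun l => ?_⟩
    · have := h.1 τ; simpa [Finset.sum_insert ha] using this
    · refine continuous_uncurry_congr (g := fun τ y => iterPartialDeriv l (fun y => f a τ y + ∑ i ∈ s, f i τ y) y) (fun τ y => ?_) (h.2 l)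
      simp only [Finset.sum_insert ha]

/-- **Leibniz closure**: the product of a scalar family and a vector family in the class is in the class (induction on the derivative word read
from the right: `∂^{l++[c]}(a•f) = ∂^l(∂_c a • f) + ∂^l(a • ∂_c f)`). -/
theorem SmoothFamily.smul {a : ℝ → UnitAddTorus (Fin 3) → ℝ} {f : ℝ → UnitAddTorus (Fin 3) → F} (ha : SmoothFamily a) (hf : SmoothFamily f) :
    SmoothFamily (fun τ y => a τ y • f τ y) := by
  refine ⟨fun τ => (ha.1 τ).smul' (hf.1 τ), fun l => ?_⟩
  -- induction on the word, from the right, for all pairs in the class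
  induction l using List.reverseRecOn generalizing a f with
  | nil =>
    exact continuous_uncurry_congr (g := fun τ y => a τ y • f τ y) (fun τ y => rfl) ((ha.2 []).smul (hf.2 []))
  | append_singleton l c ih =>
    have ha' := ha.partialDeriv c
    have hf' := hf.partialDeriv c
    have h1 := ih ha' hf
    have h2 := ih ha hf'
    refine continuous_uncurry_congr
      (g := fun τ y => iterPartialDeriv l (fun y => Torus.partialDeriv c (a τ) y • f τ y) y
        + iterPartialDeriv l (fun y => a τ y • Torus.partialDeriv c (f τ) y) y) (fun τ y => ?_) (h1.add h2)
    rw [iterPartialDeriv_concat]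
    have hprod : Torus.partialDeriv c (fun y => a τ y • f τ y)
        = fun y => Torus.partialDeriv c (a τ) y • f τ y + a τ y • Torus.partialDeriv c (f τ) y :=
      funext fun y => partialDeriv_smul' ((ha.1 τ).isContDiff (by simp)) ((hf.1 τ).isContDiff (by simp)) c y
    rw [hprod, iterPartialDeriv_add (((ha.1 τ).partialDeriv c).smul' (hf.1 τ)) ((ha.1 τ).smul' ((hf.1 τ).partialDeriv c)) l]

/-! ## §3 All iterated space derivatives of the backward reading are jointly continuous -/

/-- The transported derivative: `(T_c Ψ) τ y := Σ_i Gt τ y i c • ∂_i (Ψ τ) y` is in the class when `Ψ` and the frame entries are. -/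
theorem SmoothFamily.transport {Gt : ℝ → UnitAddTorus (Fin 3) → Matrix (Fin 3) (Fin 3) ℝ}
    (hG : ∀ c i, SmoothFamily (fun τ y => Gt τ y c i)) {Ψ : ℝ → UnitAddTorus (Fin 3) → F} (hΨ : SmoothFamily Ψ) (c : Fin 3) :
    SmoothFamily (fun τ y => ∑ i, Gt τ y i c • Torus.partialDeriv i (Ψ τ) y) :=
  SmoothFamily.sum _ fun i _ => (hG i c).smul (hΨ.partialDeriv i)

/-- **All iterated space derivatives of the BACKWARD reading `x ↦ Ψ τ (X m r₀ (t′ τ) x)` are jointly continuous in `(τ, x)`**, for every family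
`Ψ` in the class, every continuous clock `t′`, provided the frame entries `(τ, y) ↦ frameG E m (t′ τ) r₀ y c i` are in the class (for the clamped
exact-flow clock: FR2 + adjugate).  Induction on the derivative word read from the right: `∂^{l++[c]}(Ψ τ ∘ Xb τ) = ∂^l((T_c Ψ) τ ∘ Xb τ)` by
`partialDeriv_comp_backward`; at the bottom, the composite of a jointly continuous family with the jointly continuous backward maps
(`continuous_X_uncurry_snd`). -/
theorem continuous_uncurry_iterPartialDeriv_comp_backward (E : LagrangianLatticeCarrier k) (hR : E.LevelRegular) (m : ℕ) (r₀ : ℝ)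
    {t' : ℝ → ℝ} (ht' : Continuous t')
    (hG : ∀ c i, SmoothFamily (fun τ y => frameG E m (t' τ) r₀ y c i))
    {Ψ : ℝ → UnitAddTorus (Fin 3) → F} (hΨ : SmoothFamily Ψ) (l : List (Fin 3)) :
    Continuous (uncurry fun τ x => iterPartialDeriv l (fun x => Ψ τ (E.X m r₀ (t' τ) x)) x) := by
  induction l using List.reverseRecOn generalizing Ψ with
  | nil =>
    have hX : Continuous fun p : ℝ × UnitAddTorus (Fin 3) => E.X m r₀ (t' p.1) p.2 :=
      (continuous_X_uncurry_snd E hR m r₀).comp ((ht'.comp continuous_fst).prodMk continuous_snd)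
    have h := (hΨ.2 []).comp (continuous_fst.prodMk hX)
    exact h
  | append_singleton l c ih =>
    have hT := SmoothFamily.transport (Gt := fun τ y => frameG E m (t' τ) r₀ y) hG hΨ c
    have h := ih hT
    refine continuous_uncurry_congr (fun τ x => ?_) h
    rw [iterPartialDeriv_concat]
    congr 1
    funext x
    exact partialDeriv_comp_backward E hR m r₀ (t' τ) (hΨ.1 τ) c x

/-- The slices of the backward reading are smooth. -/
theorem isSmooth_comp_backward (E : LagrangianLatticeCarrier k) (hR : E.LevelRegular) (m : ℕ) (r₀ t' : ℝ)
    {θ : UnitAddTorus (Fin 3) → F} (hθ : IsSmooth θ) : IsSmooth (fun x => θ (E.X m r₀ t' x)) := by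
  have h := Literature.Analysis.ODE.TorusFlow.isSmooth_comp_add_proj hθ (hR.isSmooth_disp m r₀ t')
  have e : (fun x => θ (E.X m r₀ t' x)) = fun x => θ (x + proj (E.disp m r₀ t' x)) := by
    funext x; rw [LagrangianLatticeCarrier.X_apply]
  rw [e]; exact h

/-- **The backward reading of a family in the class is in the class** (hence satisfies the spatial clauses of `IsLipschitzSpaceTimeTest`). -/
theorem SmoothFamily.comp_backward (E : LagrangianLatticeCarrier k) (hR : E.LevelRegular) (m : ℕ) (r₀ : ℝ)
    {t' : ℝ → ℝ} (ht' : Continuous t')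
    (hG : ∀ c i, SmoothFamily (fun τ y => frameG E m (t' τ) r₀ y c i))
    {Ψ : ℝ → UnitAddTorus (Fin 3) → F} (hΨ : SmoothFamily Ψ) :
    SmoothFamily (fun τ x => Ψ τ (E.X m r₀ (t' τ) x)) :=
  ⟨fun τ => isSmooth_comp_backward E hR m r₀ (t' τ) (hΨ.1 τ),
    continuous_uncurry_iterPartialDeriv_comp_backward E hR m r₀ ht' hG hΨ⟩

end Summit.AnomalousDissipation.AnomalousDissipation.Theorems.SolenoidalFractalHomogenisation.LagrangianStep.FrameConj

end
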